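import Summits.NavierStokesRegularity.NavierStokesRegularity.Theorems.EulerZoomLiouvillePowerGaugeEulerLiouvilleBreatherWeakLocData
import Summits.NavierStokesRegularity.NavierStokesRegularity.Theorems.EulerZoomLiouvillePowerGaugeEulerLiouvilleBreatherWeakLEI
import Summits.NavierStokesRegularity.NavierStokesRegularity.Theorems.EulerZoomLiouvillePowerGaugeEulerLiouvilleWeakProfileRigidity
import Summits.NavierStokesRegularity.NavierStokesRegularity.Theorems.EulerZoomLiouvillePowerGaugeEulerLiouvillePressureSlavingBreatherProfile
import Summits.NavierStokesRegularity.NavierStokesRegularity.Theorems.EulerZoomLiouvillePowerGaugeEulerLiouvilleLogtimeBreatherExpanding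

/-!
# Crux `EulerZoomLiouville.PowerGaugeEulerLiouville` (stmt-NavierStokesRegularity-19832), line `logtime-breathers`:
# WEAK BREATHER RIGIDITY — every log-time breather in Seregin's power-gauged ancient Euler class is trivial

Width seat `ns-ezl-w4` (g3; file D2, the member).  Let `(u, p, H, c₀)` satisfy the crux hypotheses (suitable weak Euler pair on the past slab, weak
spatial gradient, the three power gauges with exponent `0 < ρ ≤ ½`) and let the velocity be a LOG-TIME BREATHER on the slab,
`u(τ, y) = e^{cτ} V(e^{−cτ} y)` for all `τ < 0`, with `c ≠ 0`.  Then `u = 0` a.e. on `(−∞,0) × ℝ³` — NO classical, tameness, finite-energy or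
pressure hypothesis (`BreatherWeak.ae_eq_zero_of_gauge_of_breather`).

* `c < 0` (expanding into the past): `A`-gauge arithmetic, the tree's `LogtimeBreather.ae_eq_zero_of_gauge_of_pastExpandingBreather` (line T2a).
* `c > 0` (`BreatherWeak.ae_eq_zero_of_gauge_of_contractingBreather`): breather PRESSURE SLAVING (ns-ezl-w3 g2,
  `PressureSlaving.inClass_breatherPressure`) replaces `p` by an a.e.-equal pressure of exact breather form `(e^{cτ})² Q(e^{−cτ}y)` in the same
  class; the profile data `(V, G, Q)` carry the large-scale class data (A₁)(E₁)(D₁) (`BreatherWeak.exists_locData`) and the weak Poisson equation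
  (`BreatherWeak.profile_pressure_poisson`); the local energy INEQUALITY tested with the co-moving cut-off gives the one-sided profile energy
  inequality `5c I_σ(L) + c J_σ(L) ≤ F_σ(L)` (`BreatherWeak.profile_energy_le`), which for `β = −c < 0`, `κ = −5` (`κ + 1 − 2ρ < 0`) is the
  input of the one-sided scale-ODE rigidity `WeakProfile.ae_eq_zero_of_locData_of_scaleIneq`: `V = 0` a.e., hence every slice `u(τ)` vanishes
  a.e. and `u = 0` a.e. on the slab (`BreatherWeak.ae_eq_zero_of_gauge_of_contractingBreather_pressure` is the form with the exact pressure clause).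

So the `IsTameBreather` stratum of `Lines/birth.lean` needs NO clause: `∃ c ≠ 0, V, ∀ τ < 0, ∀ y, u τ y = e^{cτ} • V (e^{−cτ} • y)` is trivial
(LEAD wiring: `fun … hin … hc hbr => BreatherWeak.ae_eq_zero_of_gauge_of_breather hρ hρh hin.1 hin.2.1 hin.2.2 hc hbr`).
WHAT THIS IS NOT: not NS regularity, not E — one more named WEAK stratum of the crux CLASS 19832 (MODEL lattice) closed; 19832 OPEN;
`--supports` stmt-19832. [folklore]
-/

noncomputable section

set_option linter.dupNamespace false

open MeasureTheory Set Filter Topology Metric Function TopologicalSpace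
open scoped ENNReal NNReal RealInnerProductSpace ContDiff Laplacian

namespace Summit.NavierStokesRegularity.NavierStokesRegularity.Theorems.PowerGaugeEulerLiouville

open Literature.Analysis Literature.Analysis.FunctionSpaces Literature.Analysis.FluidPDE

namespace BreatherWeak

variable {u : ℝ → EuclideanSpace ℝ (Fin 3) → EuclideanSpace ℝ (Fin 3)} {p : ℝ → EuclideanSpace ℝ (Fin 3) → ℝ}
  {H : ℝ → EuclideanSpace ℝ (Fin 3) → EuclideanSpace ℝ (Fin 3) →L[ℝ] EuclideanSpace ℝ (Fin 3)}

/-- **WEAK CONTRACTING BREATHERS WITH SLAVED PRESSURE ARE TRIVIAL.**  Crux hypotheses (`0 < ρ ≤ ½`), `u(τ, y) = e^{cτ}V(e^{−cτ}y)` and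
`p(τ, y) = (e^{cτ})² Q(e^{−cτ} y)` for all `τ < 0` with `c > 0` and `Q` measurable ⇒ `u = 0` a.e. on the slab. [folklore] -/
theorem ae_eq_zero_of_gauge_of_contractingBreather_pressure {ρ : ℝ} (hρ : 0 < ρ) (hρh : ρ ≤ 1 / 2) {c₀ : ℝ≥0}
    (hsw : IsSuitableWeakSolutionOn (slab (EuclideanSpace ℝ (Fin 3)) (Iio 0) isOpen_Iio) 0 0 u p)
    (hH : HasWeakSpatialGradientOn (slab (EuclideanSpace ℝ (Fin 3)) (Iio 0) isOpen_Iio) u H)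
    (hgauge : ∀ a : ℝ, 0 < a →
      ENNReal.ofReal (a ^ (2 * ρ)) * cknA a (0 : ℝ × EuclideanSpace ℝ (Fin 3)) u +
          ENNReal.ofReal (a ^ ρ) * cknE a (0 : ℝ × EuclideanSpace ℝ (Fin 3)) H +
        ENNReal.ofReal (a ^ (2 * ρ)) * cknD a (0 : ℝ × EuclideanSpace ℝ (Fin 3)) p ≤ (c₀ : ℝ≥0∞))
    {c : ℝ} (hc : 0 < c) {V : EuclideanSpace ℝ (Fin 3) → EuclideanSpace ℝ (Fin 3)} {Q : EuclideanSpace ℝ (Fin 3) → ℝ}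
    (hQ : Measurable Q)
    (hbr : ∀ τ : ℝ, τ < 0 → ∀ y, u τ y = Real.exp (c * τ) • V (Real.exp (-(c * τ)) • y))
    (hp : ∀ τ : ℝ, τ < 0 → ∀ y, p τ y = Real.exp (c * τ) ^ 2 * Q (Real.exp (-(c * τ)) • y)) :
    uncurry u =ᵐ[volume.restrict (Iio (0 : ℝ) ×ˢ (univ : Set (EuclideanSpace ℝ (Fin 3))))] 0 := by
  have hρ1 : ρ < 1 := by linarith
  -- ### measurability on the slab
  have hum : AEStronglyMeasurable (uncurry u)
      (volume.restrict (Iio (0 : ℝ) ×ˢ (univ : Set (EuclideanSpace ℝ (Fin 3))))) := by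
    have := hH.locallyIntegrableOn.aestronglyMeasurable
    simpa [slab] using this
  have hpm : AEStronglyMeasurable (uncurry p)
      (volume.restrict (Iio (0 : ℝ) ×ˢ (univ : Set (EuclideanSpace ℝ (Fin 3))))) := by
    have h := hsw.distributional.2.2.1.aestronglyMeasurable; rwa [coe_slab] at h
  have hQm : AEStronglyMeasurable Q volume := hQ.aestronglyMeasurable
  -- ### the profile data
  obtain ⟨G, c', hVm, hGm, hVG, hA, hE, hD⟩ := exists_locData hρ hρh hH hgauge hpm hbr hp
  have hV2 : LocallyIntegrable (fun y => ‖V y‖ ^ 2) volume :=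
    EnergySaturation.locallyIntegrable_norm_sq_of_growth_loc hVm hA
  have hQ1 : LocallyIntegrable Q volume := by
    have hD' : ∀ L : ℝ, 1 ≤ L → ∫⁻ y in ball (0 : EuclideanSpace ℝ (Fin 3)) L, ‖Q y‖ₑ ^ (3 / 2 : ℝ) ≤
        (ENNReal.ofReal ((2 - 2 * ρ) / (2 + ρ)) * (c' : ℝ≥0∞)) * ENNReal.ofReal (L ^ (2 - 2 * ρ)) :=
      fun L hL => (hD L hL).trans (le_of_eq (mul_comm _ _))
    have hQ32R := Past.memLp_threeHalves_ball_of_lintegral_lt_top hQm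
      (Past.lintegral_ball_lt_top_of_growth (ENNReal.mul_ne_top ENNReal.ofReal_ne_top ENNReal.coe_ne_top) hD')
    refine (locallyIntegrable_iff).2 fun K hK => ?_
    obtain ⟨r, hr⟩ := hK.isBounded.subset_ball (0 : EuclideanSpace ℝ (Fin 3))
    haveI : IsFiniteMeasure ((volume : Measure (EuclideanSpace ℝ (Fin 3))).restrict
        (ball (0 : EuclideanSpace ℝ (Fin 3)) r)) :=
      isFiniteMeasure_restrict.2 measure_ball_lt_top.ne
    have h : IntegrableOn Q (ball (0 : EuclideanSpace ℝ (Fin 3)) r) volume :=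
      memLp_one_iff_integrable.1 ((hQ32R r).mono_exponent (by
        rw [ENNReal.le_div_iff_mul_le (Or.inl (by norm_num)) (Or.inl (by norm_num))]; norm_num))
    exact h.mono_set hr
  have hPoisson : ∀ θ : EuclideanSpace ℝ (Fin 3) → ℝ, ContDiff ℝ (⊤ : ℕ∞) θ → HasCompactSupport θ →
      ∫ y, Q y * (Δ θ) y = -∫ y, fderiv ℝ (fderiv ℝ θ) y (V y) (V y) :=
    fun θ hθ hθc => profile_pressure_poisson hsw.distributional hVm hbr hp hV2 hQ1 hθ hθc
  -- ### `|V|³`, `|Q||V| ∈ L¹_loc` from the flux chain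
  obtain ⟨σ, hσs, hσc, h0, h1, hone, hzero, -⟩ := exists_radialCutoff
  have hσ : IsTestFunctionOn (⊤ : Opens (EuclideanSpace ℝ (Fin 3))) σ := ⟨hσs, hσc, fun _ _ => trivial⟩
  obtain ⟨M, hM⟩ := (hσs.continuous_fderiv (by simp)).bounded_above_of_compact_support (hσc.fderiv (𝕜 := ℝ))
  have hV3 : LocallyIntegrable (fun y => ‖V y‖ ^ 3) volume :=
    (EnergySaturation.locallyIntegrable_norm_cube_loc hρ hρ1 hσ h0 h1 hone hzero hM hVm hGm hVG hA hE).2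
  have hQV : LocallyIntegrable (fun y => |Q y| * ‖V y‖) volume :=
    (EnergySaturation.locallyIntegrable_pressure_velocity_loc hρ hρ1 hσ h0 h1 hone hzero hM hVm hQm hGm hVG hA hE
      hD hPoisson).2
  -- ### the one-sided profile energy inequality and the scale-ODE rigidity
  have hLE : ∀ θ : EuclideanSpace ℝ (Fin 3) → ℝ, IsTestFunctionOn (⊤ : Opens (EuclideanSpace ℝ (Fin 3))) θ →
      (∀ z, 0 ≤ θ z) → ∀ L : ℝ, 0 < L →
        (-5) * (-c) * ∫ x, θ (L⁻¹ • x) * ‖V x‖ ^ 2 ≤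
          (∫ x, (‖V x‖ ^ 2 + 2 * Q x) * ⟪V x, gradient (fun z => θ (L⁻¹ • z)) x⟫) +
            (-c) * ∫ x, ‖V x‖ ^ 2 * ⟪x, gradient (fun z => θ (L⁻¹ • z)) x⟫ :=
    fun θ hθ hθ0 L hL => profile_energy_le hsw hbr hp hVm hQm hV2 hV3 hQV hθ hθ0 hL
  have hV0 : V =ᵐ[volume] 0 :=
    WeakProfile.ae_eq_zero_of_locData_of_scaleIneq hρ hρ1 hVm hQm hGm hVG (β := -c) (κ := -5)
      (by linarith) (by linarith) hA hE hD hPoisson hLE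
  -- ### every slice vanishes a.e., hence `u = 0` a.e. on the slab
  have hslice : ∀ τ : ℝ, τ < 0 → u τ =ᵐ[volume] 0 := by
    intro τ hτ
    have hd : Real.exp (-(c * τ)) ≠ 0 := (Real.exp_pos _).ne'
    have ht := (quasiMeasurePreserving_smul hd).ae_eq_comp hV0
    filter_upwards [ht] with y hy
    rw [hbr τ hτ y]
    simp only [comp_apply, Pi.zero_apply] at hy
    rw [hy, smul_zero, Pi.zero_apply]
  have hum' : AEStronglyMeasurable (uncurry u)
      (((volume : Measure ℝ).restrict (Iio (0 : ℝ))).prod (volume : Measure (EuclideanSpace ℝ (Fin 3)))) := by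
    rw [Measure.volume_eq_prod, ← Measure.prod_restrict, Measure.restrict_univ] at hum
    exact hum
  have hae : ∀ᵐ τ ∂((volume : Measure ℝ).restrict (Iio (0 : ℝ))),
      (fun y => uncurry u (τ, y)) =ᵐ[volume] fun y => (0 : ℝ → EuclideanSpace ℝ (Fin 3) → EuclideanSpace ℝ (Fin 3)).uncurry (τ, y) := by
    filter_upwards [ae_restrict_mem measurableSet_Iio] with τ hτ
    exact hslice τ hτ
  have h := ae_eq_prod_of_ae_ae_eq hum' (aestronglyMeasurable_const (b := (0 : EuclideanSpace ℝ (Fin 3)))) hae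
  rw [Measure.volume_eq_prod, ← Measure.prod_restrict, Measure.restrict_univ]
  exact h

/-- **WEAK CONTRACTING BREATHERS ARE TRIVIAL (u-only).**  Crux hypotheses (`0 < ρ ≤ ½`) and `u(τ, y) = e^{cτ}V(e^{−cτ}y)` for all `τ < 0` with
`c > 0` ⇒ `u = 0` a.e. on the slab: the pressure clause of `ae_eq_zero_of_gauge_of_contractingBreather_pressure` is supplied by breather pressure
slaving (`PressureSlaving.inClass_breatherPressure`, ns-ezl-w3 g2). [folklore] -/
theorem ae_eq_zero_of_gauge_of_contractingBreather {ρ : ℝ} (hρ : 0 < ρ) (hρh : ρ ≤ 1 / 2) {c₀ : ℝ≥0}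
    (hsw : IsSuitableWeakSolutionOn (slab (EuclideanSpace ℝ (Fin 3)) (Iio 0) isOpen_Iio) 0 0 u p)
    (hH : HasWeakSpatialGradientOn (slab (EuclideanSpace ℝ (Fin 3)) (Iio 0) isOpen_Iio) u H)
    (hgauge : ∀ a : ℝ, 0 < a →
      ENNReal.ofReal (a ^ (2 * ρ)) * cknA a (0 : ℝ × EuclideanSpace ℝ (Fin 3)) u +
          ENNReal.ofReal (a ^ ρ) * cknE a (0 : ℝ × EuclideanSpace ℝ (Fin 3)) H +
        ENNReal.ofReal (a ^ (2 * ρ)) * cknD a (0 : ℝ × EuclideanSpace ℝ (Fin 3)) p ≤ (c₀ : ℝ≥0∞))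
    {c : ℝ} (hc : 0 < c) {V : EuclideanSpace ℝ (Fin 3) → EuclideanSpace ℝ (Fin 3)}
    (hbr : ∀ τ : ℝ, τ < 0 → ∀ y, u τ y = Real.exp (c * τ) • V (Real.exp (-(c * τ)) • y)) :
    uncurry u =ᵐ[volume.restrict (Iio (0 : ℝ) ×ˢ (univ : Set (EuclideanSpace ℝ (Fin 3))))] 0 := by
  obtain ⟨Q, p', hQ, hp', -, hsw', hH', hgauge'⟩ :=
    PressureSlaving.inClass_breatherPressure (by linarith : -1 / 2 < ρ) ⟨hsw, hH, hgauge⟩ hbr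
  exact ae_eq_zero_of_gauge_of_contractingBreather_pressure hρ hρh hsw' hH' hgauge' hc hQ hbr hp'

/-- **WEAK BREATHER RIGIDITY — EVERY LOG-TIME BREATHER IN THE CLASS IS TRIVIAL.**  Crux hypotheses (`0 < ρ ≤ ½`) and
`u(τ, y) = e^{cτ}V(e^{−cτ}y)` for all `τ < 0` with `c ≠ 0` (any profile `V`; no classical / tameness / energy / pressure hypothesis) ⇒ `u = 0` a.e.
on the slab (`c < 0`: `LogtimeBreather.ae_eq_zero_of_gauge_of_pastExpandingBreather`; `c > 0`: `ae_eq_zero_of_gauge_of_contractingBreather`).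
This subsumes the classical `BreatherRigidity.ae_eq_zero_of_gauge_of_classicalBreather` and both weak disjuncts of `IsTameBreather`. [folklore] -/
theorem ae_eq_zero_of_gauge_of_breather {ρ : ℝ} (hρ : 0 < ρ) (hρh : ρ ≤ 1 / 2) {c₀ : ℝ≥0}
    (hsw : IsSuitableWeakSolutionOn (slab (EuclideanSpace ℝ (Fin 3)) (Iio 0) isOpen_Iio) 0 0 u p)
    (hH : HasWeakSpatialGradientOn (slab (EuclideanSpace ℝ (Fin 3)) (Iio 0) isOpen_Iio) u H)
    (hgauge : ∀ a : ℝ, 0 < a →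
      ENNReal.ofReal (a ^ (2 * ρ)) * cknA a (0 : ℝ × EuclideanSpace ℝ (Fin 3)) u +
          ENNReal.ofReal (a ^ ρ) * cknE a (0 : ℝ × EuclideanSpace ℝ (Fin 3)) H +
        ENNReal.ofReal (a ^ (2 * ρ)) * cknD a (0 : ℝ × EuclideanSpace ℝ (Fin 3)) p ≤ (c₀ : ℝ≥0∞))
    {c : ℝ} (hc : c ≠ 0) {V : EuclideanSpace ℝ (Fin 3) → EuclideanSpace ℝ (Fin 3)}
    (hbr : ∀ τ : ℝ, τ < 0 → ∀ y, u τ y = Real.exp (c * τ) • V (Real.exp (-(c * τ)) • y)) :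
    uncurry u =ᵐ[volume.restrict (Iio (0 : ℝ) ×ˢ (univ : Set (EuclideanSpace ℝ (Fin 3))))] 0 := by
  rcases lt_or_gt_of_ne hc with hneg | hpos
  · exact LogtimeBreather.ae_eq_zero_of_gauge_of_pastExpandingBreather hρ.le hsw hH hgauge hneg hbr
  · exact ae_eq_zero_of_gauge_of_contractingBreather hρ hρh hsw hH hgauge hpos hbr

end BreatherWeak

end Summit.NavierStokesRegularity.NavierStokesRegularity.Theorems.PowerGaugeEulerLiouville

end
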